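import Literature.Topology.FourManifolds.LeeRasmussenProofs
import HarnessLib

/-!
# The Koszul potential of an arbitrary transposition of two chords

Sibling file of `KhComplex.lean` (used by the third Reidemeister move, where the smoothings of
the two chords `x, y` of the moving strand are exchanged between the two sides):
`LeeRasmussenProofs.edgeSign_swap` computes the change of the Koszul signs of the cube under an
*adjacent* transposition of the numbering of the chords; here the same is done for the
transposition of two arbitrary chords `x ≠ y` (`edgeSign_comp_swap`), with the explicit
potential `koszulXY x y σ = (-1)^{[σ x ∧ σ y]} · (∏_{k strictly between x and y} (-1)^{σ k})^{[σ x ≠ σ y]}`.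
Khovanov (2000), §3.3 (independence of the ordering of the crossings). No named fact is
introduced.

## References

* M. Khovanov, *A categorification of the Jones polynomial*, Duke Math. J. 101 (2000) 359–426,
  §3.3. [cite: Khovanov2000, §3.3]
-/

open Function Finset

namespace Literature.Topology.FourManifolds

namespace GaussDiagram

variable {G : GaussDiagram}

/-- The sign of a smoothing: `-1` for `1`, `+1` for `0`. [folklore] -/
def bsgn (b : Bool) : ℤ := if b = true then -1 else 1

/-- `bsgn` is a sign. [folklore] -/
@[simp] theorem bsgn_mul_self (b : Bool) : bsgn b * bsgn b = 1 := by cases b <;> rfl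
/-- `bsgn 0 = 1`. [folklore] -/
@[simp] theorem bsgn_false : bsgn false = 1 := rfl
/-- `bsgn 1 = -1`. [folklore] -/
@[simp] theorem bsgn_true : bsgn true = -1 := rfl

/-- The Koszul sign as a product of smoothing signs below the chord. [folklore] -/
theorem edgeSign_eq_prod_bsgn (σ : G.State) (i : Fin G.n) :
    edgeSign σ i = ∏ j, if j < i then bsgn (σ j) else 1 := by
  rw [edgeSign_eq_prod]
  refine Finset.prod_congr rfl fun j _ ↦ ?_
  unfold bsgn
  by_cases h : j < i <;> cases σ j <;> simp [h]

/-- Two indicator signs multiply to the indicator sign of the exclusive disjunction. [folklore] -/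
theorem ite_bsgn_mul_ite_bsgn (p q : Prop) [Decidable p] [Decidable q] (b : Bool) :
    (if p then bsgn b else 1) * (if q then bsgn b else 1) = if ¬ (p ↔ q) then bsgn b else 1 := by
  by_cases hp : p <;> by_cases hq : q <;> simp [hp, hq]

variable (x y : Fin G.n)

/-- **The product of signed smoothings strictly between two chords.** [folklore] -/
def btwSgn (σ : G.State) : ℤ := ∏ k, if (x < k ∧ k < y) ∨ (y < k ∧ k < x) then bsgn (σ k) else 1

/-- **The Koszul potential of the transposition `(x y)`.** Khovanov (2000), §3.3. [cite: Khovanov2000, §3.3] -/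
def koszulXY (σ : G.State) : ℤ :=
  (if σ x = true ∧ σ y = true then -1 else 1) * (if σ x = σ y then 1 else btwSgn x y σ)

/-- `btwSgn` is a sign. [folklore] -/
theorem btwSgn_mul_self (σ : G.State) : btwSgn x y σ * btwSgn x y σ = 1 := by
  unfold btwSgn
  rw [← Finset.prod_mul_distrib]
  refine Finset.prod_eq_one fun k _ ↦ ?_
  split_ifs <;> simp

/-- The Koszul potential is a sign. [folklore] -/
theorem koszulXY_mul_self (σ : G.State) : koszulXY x y σ * koszulXY x y σ = 1 := by
  unfold koszulXY
  have := btwSgn_mul_self x y σ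
  split_ifs <;> nlinarith [this]

variable {x y}

/-- `btwSgn` after flipping a chord strictly between `x` and `y`. [folklore] -/
theorem btwSgn_update_of_btw {σ : G.State} {i : Fin G.n} (hi : σ i = false)
    (hbtw : (x < i ∧ i < y) ∨ (y < i ∧ i < x)) : btwSgn x y (Function.update σ i true) = -btwSgn x y σ := by
  unfold btwSgn
  rw [← Finset.mul_prod_erase _ _ (Finset.mem_univ i), ← Finset.mul_prod_erase univ
    (fun k ↦ if (x < k ∧ k < y) ∨ (y < k ∧ k < x) then bsgn (σ k) else 1) (Finset.mem_univ i)]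
  rw [if_pos hbtw, if_pos hbtw, Function.update_self, hi, bsgn_true, bsgn_false, one_mul, neg_one_mul, neg_inj]
  refine Finset.prod_congr rfl fun k hk ↦ ?_
  rw [Function.update_of_ne (Finset.mem_erase.1 hk).1]

/-- `btwSgn` after flipping a chord not strictly between `x` and `y`. [folklore] -/
theorem btwSgn_update_of_not_btw {σ : G.State} {i : Fin G.n}
    (hbtw : ¬ ((x < i ∧ i < y) ∨ (y < i ∧ i < x))) : btwSgn x y (Function.update σ i true) = btwSgn x y σ := by
  unfold btwSgn
  refine Finset.prod_congr rfl fun k _ ↦ ?_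
  by_cases hk : k = i
  · subst hk; rw [if_neg hbtw, if_neg hbtw]
  · rw [Function.update_of_ne hk]

/-- The exclusive-disjunction product computing the change of Koszul signs under `(x y)`. [folklore] -/
theorem edgeSign_comp_swap_mul (σ : G.State) (i : Fin G.n) :
    edgeSign (σ ∘ Equiv.swap x y) (Equiv.swap x y i) * edgeSign σ i =
      ∏ k, if ¬ (Equiv.swap x y k < Equiv.swap x y i ↔ k < i) then bsgn (σ k) else 1 := by
  rw [edgeSign_eq_prod_bsgn, edgeSign_eq_prod_bsgn, ← Equiv.prod_comp (Equiv.swap x y)]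
  simp only [comp_apply, Equiv.swap_apply_self]
  rw [← Finset.prod_mul_distrib]
  exact Finset.prod_congr rfl fun k _ ↦ ite_bsgn_mul_ite_bsgn _ _ _

/-- Evaluation of the exclusive-disjunction product: split off the factors at `x` and `y`.
[folklore] -/
theorem prod_xor_eq (hxy : x ≠ y) (σ : G.State) (i : Fin G.n) :
    (∏ k, if ¬ (Equiv.swap x y k < Equiv.swap x y i ↔ k < i) then bsgn (σ k) else 1) =
      (if ¬ (y < Equiv.swap x y i ↔ x < i) then bsgn (σ x) else 1) *
        ((if ¬ (x < Equiv.swap x y i ↔ y < i) then bsgn (σ y) else 1) *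
          ∏ k ∈ (univ.erase x).erase y, if ¬ (k < Equiv.swap x y i ↔ k < i) then bsgn (σ k) else 1) := by
  rw [← Finset.mul_prod_erase _ _ (Finset.mem_univ x), Equiv.swap_apply_left,
    ← Finset.mul_prod_erase _ _ (Finset.mem_erase.2 ⟨fun h ↦ hxy h.symm, Finset.mem_univ y⟩), Equiv.swap_apply_right]
  congr 2
  refine Finset.prod_congr rfl fun k hk ↦ ?_
  have hky : k ≠ y := (Finset.mem_erase.1 hk).1
  have hkx : k ≠ x := (Finset.mem_erase.1 (Finset.mem_erase.1 hk).2).1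
  rw [Equiv.swap_apply_of_ne_of_ne hkx hky]

/-- The remaining product, for `i = x`, is `btwSgn`. [folklore] -/
theorem prod_erase_erase_eq_btwSgn (hxy : x ≠ y) (σ : G.State) :
    (∏ k ∈ (univ.erase x).erase y, if ¬ (k < y ↔ k < x) then bsgn (σ k) else 1) = btwSgn x y σ := by
  unfold btwSgn
  rw [← Finset.mul_prod_erase univ _ (Finset.mem_univ x),
    ← Finset.mul_prod_erase (univ.erase x) _ (Finset.mem_erase.2 ⟨fun h ↦ hxy h.symm, Finset.mem_univ y⟩)]
  rw [if_neg (by simp), if_neg (by simp), one_mul, one_mul]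
  refine Finset.prod_congr rfl fun k hk ↦ ?_
  have hky : k ≠ y := (Finset.mem_erase.1 hk).1
  have hkx : k ≠ x := (Finset.mem_erase.1 (Finset.mem_erase.1 hk).2).1
  have e : (¬ (k < y ↔ k < x)) ↔ ((x < k ∧ k < y) ∨ (y < k ∧ k < x)) := by
    have hkx' : (k : ℕ) ≠ x := fun h ↦ hkx (Fin.ext h)
    have hky' : (k : ℕ) ≠ y := fun h ↦ hky (Fin.ext h)
    simp only [Fin.lt_def]
    omega
  by_cases hc : (x < k ∧ k < y) ∨ (y < k ∧ k < x)
  · rw [if_pos hc, if_pos (e.2 hc)]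
  · rw [if_neg hc, if_neg (fun h ↦ hc (e.1 h))]

/-- The remaining product, for `i ∉ {x, y}`, is `1`. [folklore] -/
theorem prod_erase_erase_eq_one (σ : G.State) (i : Fin G.n) :
    (∏ k ∈ (univ.erase x).erase y, if ¬ (k < i ↔ k < i) then bsgn (σ k) else 1) = 1 :=
  Finset.prod_eq_one fun k _ ↦ by rw [if_neg (by simp)]

/-- The remaining product, for `i = y`, is `btwSgn`. [folklore] -/
theorem prod_erase_erase_eq_btwSgn' (hxy : x ≠ y) (σ : G.State) :
    (∏ k ∈ (univ.erase x).erase y, if ¬ (k < x ↔ k < y) then bsgn (σ k) else 1) = btwSgn x y σ := by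
  rw [← prod_erase_erase_eq_btwSgn hxy σ]
  exact Finset.prod_congr rfl fun k _ ↦ by simp only [iff_comm]

/-- **The Koszul signs under the transposition of two chords.** For `x ≠ y`, the transposition
`π = (x y)` of the numbering and a `0`-smoothed chord `i` of `σ`:
`sgn(σ ∘ π, π i) = κ(σ) κ(σ[i ↦ 1]) sgn(σ, i)` with `κ = koszulXY x y`. Khovanov (2000), §3.3.
[cite: Khovanov2000, §3.3] -/
theorem edgeSign_comp_swap (hxy : x ≠ y) (σ : G.State) (i : Fin G.n) (hi : σ i = false) :
    edgeSign (σ ∘ Equiv.swap x y) (Equiv.swap x y i) =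
      koszulXY x y σ * koszulXY x y (Function.update σ i true) * edgeSign σ i := by
  have hsq := Transfer.edgeSign_mul_self (R := ℤ) σ i
  push_cast at hsq
  suffices key : edgeSign (σ ∘ Equiv.swap x y) (Equiv.swap x y i) * edgeSign σ i =
      koszulXY x y σ * koszulXY x y (Function.update σ i true) by
    linear_combination (edgeSign σ i) * key - (edgeSign (σ ∘ ⇑(Equiv.swap x y)) (Equiv.swap x y i)) * hsq
  rw [edgeSign_comp_swap_mul, prod_xor_eq hxy]
  have hxy' : (x : ℕ) ≠ y := fun h ↦ hxy (Fin.ext h)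
  unfold koszulXY
  by_cases hix : i = x
  · subst hix
    rw [Equiv.swap_apply_left, prod_erase_erase_eq_btwSgn hxy]
    have h1 : ¬ ¬ (y < y ↔ i < i) := by simp
    have h2 : ¬ (i < y ↔ y < i) := by simp only [Fin.lt_def]; omega
    have h3 : ¬ ((i < i ∧ i < y) ∨ (y < i ∧ i < i)) := by simp
    rw [if_neg h1, if_pos h2, one_mul, hi, Function.update_self, Function.update_of_ne hxy.symm,
      btwSgn_update_of_not_btw h3]
    cases σ y <;> simp
  by_cases hiy : i = y
  · subst hiy
    rw [Equiv.swap_apply_right, prod_erase_erase_eq_btwSgn' hxy]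
    have h1 : ¬ (i < x ↔ x < i) := by simp only [Fin.lt_def]; omega
    have h2 : ¬ ¬ (x < x ↔ i < i) := by simp
    have h3 : ¬ ((x < i ∧ i < i) ∨ (i < i ∧ i < x)) := by simp
    rw [if_pos h1, if_neg h2, one_mul, hi, Function.update_self, Function.update_of_ne hxy,
      btwSgn_update_of_not_btw h3]
    cases σ x <;> simp
  · rw [Equiv.swap_apply_of_ne_of_ne hix hiy, prod_erase_erase_eq_one, mul_one,
      Function.update_of_ne (fun h ↦ hix h.symm), Function.update_of_ne (fun h ↦ hiy h.symm)]
    have hix' : (i : ℕ) ≠ x := fun h ↦ hix (Fin.ext h)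
    have hiy' : (i : ℕ) ≠ y := fun h ↦ hiy (Fin.ext h)
    have hB1 : (¬ (y < i ↔ x < i)) ↔ ((x < i ∧ i < y) ∨ (y < i ∧ i < x)) := by simp only [Fin.lt_def]; omega
    have hB2 : (¬ (x < i ↔ y < i)) ↔ ((x < i ∧ i < y) ∨ (y < i ∧ i < x)) := by simp only [Fin.lt_def]; omega
    have hb2 := btwSgn_mul_self x y σ
    by_cases hB : (x < i ∧ i < y) ∨ (y < i ∧ i < x)
    · rw [if_pos (hB1.2 hB), if_pos (hB2.2 hB), btwSgn_update_of_btw hi hB]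
      cases σ x <;> cases σ y <;> simp [hb2]
    · rw [if_neg (fun h ↦ hB (hB1.1 h)), if_neg (fun h ↦ hB (hB2.1 h)), btwSgn_update_of_not_btw hB]
      cases σ x <;> cases σ y <;> simp [hb2]

end GaussDiagram

end Literature.Topology.FourManifolds
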